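import Summits.QuantumFields.YangMills.Theorems.BalabanUVNodesN09RegularityTowerSelOfThm1OfNumerics
import HarnessLib

/-!
# BalabanUVNodes ∕ N09 — THE ONE-RADIUS ROAD-B RECORD DOOR's NUMERICS ROW: its PRICE `4·B₃² < L²` (forced by the strict (hord) and the object-slot letter `2B₃²ε₀ ≤ εbg = εreg`)
# and its JOINT INHABITATION under that price (A6 hygiene on this seat's own p648020 door)

Cell `pub-ymgap`, width seat `pub-ymgap-dag-n09-w2` generation 5 (HUMAN RULING D-0149; DAG node N09 = [Balaban1987RG1] §§2–5; INBOX CLAIM-8∕INTENT-12 l.41001).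
`--kind proof --supports stmt-QuantumFields-27364 --as helper` (K1⁹ `StabilityBRunRowsAtRecordR13SepCoPHV`; count-neutral; theorems only, 0 def ∕ 0 instance ∕ 0 notation ∕ 0 sorry).

WHY.  `…N09RecordDoorOfLocalRouteOfThm1Objects` (p648020) displays road B's record door at ONE background radius (`εreg = εbg`) with the numerics letters of the local route
(strict (hord) `2εreg∕L² + 4·max(ε₂₉, 10ℓε₂₉L^{d−1}) < ε₀`, …) AND of dag-n09-w1 g7's object-slot road (`2B₃·(B₃·ε₀) ≤ εbg`, …).  Two of them pull in opposite directions — (hord) wants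
`ε₀ > 2εreg∕L²`, the object-slot letter wants `εreg = εbg ≥ 2B₃²ε₀` — and are jointly satisfiable IFF the block size beats [B11]'s constant: `4B₃² < L²`.  §1 proves the price is FORCED
by the displayed letters; §2 proves that under the price (and `0 < a₀`, `0 < a₁`, `1 ≤ B₃`) ALL EIGHTEEN numerics letters of the door are met by SOME `(εreg = εbg, ε₂₉, ε₀)` — so the door is
not vacuous in its numerics exactly when `L > 2B₃` (print takes `L` large; whether the RECORD's numerics row ∕ N07's `B₃` meet it is K0⁷'s ∕ N07's, not claimed).

WHAT IS PROVED (theorems only; torus `K` of the family `F`, `SU(N)`).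
§1 ★ `four_mul_sq_lt_sq_of_hord_of_hB` (the price `4·B₃² < L²` from (hord) + `2B₃(B₃ε₀) ≤ εreg` + `0 < ε₂₉`, `0 < ε₀`).
§2 `eventually_nhdsGT_lt_of_continuous_of_lt` (device: `f` continuous, `f 0 < b` ⇒ eventually `f s < b` on `𝓝[>] 0`), ★★ `recordDoor_localRoute_numerics_inhabited` (the eighteen letters of
   p648020's door, `εbg := εreg`, jointly inhabited under `4B₃² < L²`, `0 < a₀`, `0 < a₁`, `1 ≤ B₃`; witness `ε₀ ↓ 0`, `εreg := 2B₃(B₃ε₀)`, then `ε₂₉ ↓ 0`).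

HONEST FRAMING.  Count-neutral real-arithmetic bookkeeping about THIS door's displayed letters; NOTHING of Bałaban's asserted; no record's numerics row is claimed to meet them; N09 NOT
discharged; conjunct 1 (Lemma 4) ∕ FLAG №7 untouched; K0⁷ ∕ K1⁹ ∕ K2⁹ ∕ K3⁸ NOT closed; counts unmoved (typed 28∕28 · discharged 5∕28); no summit statement is proved here; R4 = the
conditional finite-𝕋⁴ rung `BalabanLadder.UV` only — NOT continuum ∕ ℝ⁴ ∕ OS; the Yang–Mills mass gap (Clay) is NOT proved by any of this.
-/

noncomputable section

open Filter Topology Set Function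

namespace Summit.QuantumFields.YangMills.BalabanUVNodes.N09RecordDoorOfLocalRouteNumerics

open Literature.MathematicalPhysics.QuantumFieldTheory.Balaban1983to89
open Literature.MathematicalPhysics.QuantumFieldTheory.Balaban1983to89.T4Continuum (T4Family)
open Literature.MathematicalPhysics.QuantumFieldTheory.Balaban1983to89.ExpMeanLog (deltaSU deltaSU_pos)
open Literature.MathematicalPhysics.QuantumFieldTheory.Balaban1983to89.FederbushMean (deltaFed deltaFed_pos)
open Summit.QuantumFields.YangMills.BalabanUVNodes.N09RegularityTowerSelOfThm1OfNumerics (eventually_nhdsGT_lt_of_continuous eventually_nhdsGT_le_of_continuous)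

variable {F : T4Family} {N : ℕ} [NeZero N]

/-! ## §1 The price of the one-radius door -/

omit [NeZero N] in
/-- ★ **THE ONE-RADIUS DOOR's PRICE `4·B₃² < L²`**: the strict (hord) of the local route (`0 < ε₂₉`) and the object-slot letter `2B₃·(B₃·ε₀) ≤ εreg` (`= εbg`) with `0 < ε₀` force
`4·B₃² < L²`. [cite: Balaban1987RG1, p.259 (the `ε₀`-domains); Balaban1985Variational, Thm 1 (8) p.279 (bookkeeping of the displayed letters)] -/
theorem four_mul_sq_lt_sq_of_hord_of_hB {K : ℕ} {εreg ε₂₉ ε₀ B₃ : ℝ} (hε : 0 < ε₂₉) (hε₀ : 0 < ε₀)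
    (hord' : 2 * εreg / ((F.P K).L : ℝ) ^ 2 +
      4 * max ε₂₉ (10 * (((((F.P K).d + 2) * (F.P K).L : ℕ) : ℝ) * ε₂₉) * ((F.P K).L : ℝ) ^ ((F.P K).d - 1)) < ε₀)
    (hB : 2 * B₃ * (B₃ * ε₀) ≤ εreg) : 4 * B₃ ^ 2 < ((F.P K).L : ℝ) ^ 2 := by
  have hL0 : (0 : ℝ) < (F.P K).L := by exact_mod_cast (F.P K).L_pos
  have hm : 0 ≤ 4 * max ε₂₉ (10 * (((((F.P K).d + 2) * (F.P K).L : ℕ) : ℝ) * ε₂₉) * ((F.P K).L : ℝ) ^ ((F.P K).d - 1)) :=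
    mul_nonneg (by norm_num) (le_max_of_le_left hε.le)
  have h2 : 2 * εreg / ((F.P K).L : ℝ) ^ 2 < ε₀ := by linarith
  have h3 : 2 * εreg < ε₀ * ((F.P K).L : ℝ) ^ 2 := (div_lt_iff₀ (pow_pos hL0 2)).1 h2
  have h4 : 4 * B₃ ^ 2 * ε₀ < ((F.P K).L : ℝ) ^ 2 * ε₀ := by nlinarith
  exact lt_of_mul_lt_mul_right h4 hε₀.le

/-! ## §2 Joint inhabitation under the price -/

omit [NeZero N] in
/-- Device: a continuous real function with `f 0 < b` is eventually `< b` on `𝓝[>] 0`. [folklore] -/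
theorem eventually_nhdsGT_lt_of_continuous_of_lt {f : ℝ → ℝ} (hf : Continuous f) {b : ℝ} (h0 : f 0 < b) : ∀ᶠ t in 𝓝[>] (0 : ℝ), f t < b :=
  ((hf.tendsto 0).eventually_lt_const h0).filter_mono nhdsWithin_le_nhds

/-- ★★ **THE ONE-RADIUS ROAD-B RECORD DOOR's EIGHTEEN NUMERICS LETTERS ARE JOINTLY INHABITED UNDER THE PRICE** `4·B₃² < L²` (and `0 < a₀`, `0 < a₁`, `1 ≤ B₃`): with `εbg := εreg` SOME
`(εreg, ε₂₉, ε₀)` meet [B7] on `εreg`, the rider's `hn1 hn2`, the three `ε₀`-lines, the strict (hord), `((dL)²∕4)·ε₀ < δ_Fed`, `0 < ε₀ ≤ a₁`, (53) at `B₃ε₀`, `2B₃ε₀ ≤ a₁`, `2B₃(B₃ε₀) ≤ εreg ≤ a₀`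
(witness: `ε₀ ↓ 0`, `εreg := 2B₃(B₃ε₀)`, `ε₂₉ ↓ 0`).  Non-vacuity of p648020's displayed row for SOME numerics — NOT the record's row.
[cite: Balaban1987RG1, p.259 and (2.9)–(2.10) p.266–267; Balaban1985Averaging, Prop. 2 (53) p.26; Balaban1985Variational, Thm 1 (8) p.279] -/
theorem recordDoor_localRoute_numerics_inhabited (F : T4Family) (N : ℕ) [NeZero N] (K : ℕ) {a₀ a₁ B₃ : ℝ} (ha₀ : 0 < a₀) (ha₁ : 0 < a₁) (hB₃ : 1 ≤ B₃)
    (hLB : 4 * B₃ ^ 2 < ((F.P K).L : ℝ) ^ 2) :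
    ∃ εreg ε₂₉ ε₀ : ℝ, 0 < ε₂₉ ∧ 0 < εreg ∧
      (143 * (((((F.P K).d + 4 : ℕ) : ℝ)) ^ 2 / 4) ^ 2) * εreg ≤ 1 / 3 ∧
      2 * εreg ≤ 2 * deltaSU (Fin N) / ((((F.P K).d + 4) * (F.P K).L : ℕ) : ℝ) ^ 2 ∧
      1640 * (2 * (((((F.P K).d + 2) * (F.P K).L : ℕ) : ℝ) * ε₂₉) + ((((F.P K).d + 2) * (F.P K).L : ℕ) : ℝ) ^ 2 / 4 * (2 * εreg / ((F.P K).L : ℝ) ^ 2)) *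
          (((F.P K).L : ℝ) ^ ((F.P K).d - 1)) ^ 2 ≤ 1 ∧
      13 * (2 * (((((F.P K).d + 2) * (F.P K).L : ℕ) : ℝ) * ε₂₉) + ((((F.P K).d + 2) * (F.P K).L : ℕ) : ℝ) ^ 2 / 4 * (2 * εreg / ((F.P K).L : ℝ) ^ 2)) *
          ((F.P K).L : ℝ) ^ ((F.P K).d - 1) < deltaSU (Fin N) ∧
      ((((F.P K).d + 2) * (F.P K).L : ℕ) : ℝ) ^ 2 / 4 * ε₀ < 1 / 24 ∧
      64 * (((((F.P K).d + 2) * (F.P K).L : ℕ) : ℝ) ^ 2 / 4 * ε₀) < deltaSU (Fin N) ∧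
      157 * (((((F.P K).d + 2) * (F.P K).L : ℕ) : ℝ) ^ 2 / 4 * ε₀) < ((((F.P K).L : ℝ)) ^ ((F.P K).d - 1))⁻¹ ∧
      2 * εreg / ((F.P K).L : ℝ) ^ 2 + 4 * max ε₂₉ (10 * (((((F.P K).d + 2) * (F.P K).L : ℕ) : ℝ) * ε₂₉) * ((F.P K).L : ℝ) ^ ((F.P K).d - 1)) < ε₀ ∧
      ((((F.P K).d * (F.P K).L : ℕ) : ℝ)) ^ 2 / 4 * ε₀ < deltaFed (Fin N) ∧
      0 < ε₀ ∧ ε₀ ≤ a₁ ∧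
      (143 * (((((F.P K).d + 4 : ℕ) : ℝ)) ^ 2 / 4) ^ 2) * (B₃ * ε₀) ≤ 1 / 3 ∧
      2 * (B₃ * ε₀) ≤ 2 * deltaSU (Fin N) / ((((F.P K).d + 4) * (F.P K).L : ℕ) : ℝ) ^ 2 ∧
      2 * (B₃ * ε₀) ≤ a₁ ∧ 2 * B₃ * (B₃ * ε₀) ≤ εreg ∧ εreg ≤ a₀ := by
  have hδ : 0 < deltaSU (Fin N) := deltaSU_pos
  have hδF : 0 < deltaFed (Fin N) := deltaFed_pos
  have hL0 : (0 : ℝ) < (F.P K).L := by exact_mod_cast (F.P K).L_pos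
  have hΛ : 0 < (((F.P K).L : ℝ) ^ ((F.P K).d - 1))⁻¹ := inv_pos.2 (pow_pos hL0 _)
  have hℓ4 : (0 : ℝ) < ((((F.P K).d + 4) * (F.P K).L : ℕ) : ℝ) := by exact_mod_cast Nat.mul_pos (by omega) (F.P K).L_pos
  have hq : 0 < 2 * deltaSU (Fin N) / ((((F.P K).d + 4) * (F.P K).L : ℕ) : ℝ) ^ 2 := div_pos (mul_pos two_pos hδ) (pow_pos hℓ4 2)
  have hB0 : 0 < B₃ := by linarith
  have h0 : ∀ᶠ t in 𝓝[>] (0 : ℝ), 0 < t := self_mem_nhdsWithin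
  -- STEP 1: the domain threshold `ε₀ = t ↓ 0` (with `εreg := 2B₃(B₃t)` substituted in the `εreg`-letters and in the `ε₂₉ = 0` ends of the rider's rows)
  have Hε₀ := h0.and <|
    (eventually_nhdsGT_lt_of_continuous (f := fun t : ℝ => ((((F.P K).d + 2) * (F.P K).L : ℕ) : ℝ) ^ 2 / 4 * t) (by fun_prop) (by simp)
      (by norm_num : (0 : ℝ) < 1 / 24)).and <|
    (eventually_nhdsGT_lt_of_continuous (f := fun t : ℝ => 64 * (((((F.P K).d + 2) * (F.P K).L : ℕ) : ℝ) ^ 2 / 4 * t)) (by fun_prop) (by simp) hδ).and <|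
    (eventually_nhdsGT_lt_of_continuous (f := fun t : ℝ => 157 * (((((F.P K).d + 2) * (F.P K).L : ℕ) : ℝ) ^ 2 / 4 * t)) (by fun_prop) (by simp) hΛ).and <|
    (eventually_nhdsGT_lt_of_continuous (f := fun t : ℝ => ((((F.P K).d * (F.P K).L : ℕ) : ℝ)) ^ 2 / 4 * t) (by fun_prop) (by simp) hδF).and <|
    (eventually_nhdsGT_le_of_continuous (f := fun t : ℝ => t) continuous_id rfl ha₁).and <|
    (eventually_nhdsGT_le_of_continuous (f := fun t : ℝ => (143 * (((((F.P K).d + 4 : ℕ) : ℝ)) ^ 2 / 4) ^ 2) * (B₃ * t)) (by fun_prop) (by simp)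
      (by norm_num : (0 : ℝ) < 1 / 3)).and <|
    (eventually_nhdsGT_le_of_continuous (f := fun t : ℝ => 2 * (B₃ * t)) (by fun_prop) (by simp) hq).and <|
    (eventually_nhdsGT_le_of_continuous (f := fun t : ℝ => 2 * (B₃ * t)) (by fun_prop) (by simp) ha₁).and <|
    (eventually_nhdsGT_le_of_continuous (f := fun t : ℝ => (143 * (((((F.P K).d + 4 : ℕ) : ℝ)) ^ 2 / 4) ^ 2) * (2 * B₃ * (B₃ * t))) (by fun_prop) (by simp)
      (by norm_num : (0 : ℝ) < 1 / 3)).and <|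
    (eventually_nhdsGT_le_of_continuous (f := fun t : ℝ => 2 * (2 * B₃ * (B₃ * t))) (by fun_prop) (by simp) hq).and <|
    (eventually_nhdsGT_le_of_continuous (f := fun t : ℝ => 2 * B₃ * (B₃ * t)) (by fun_prop) (by simp) ha₀).and <|
    (eventually_nhdsGT_lt_of_continuous (f := fun t : ℝ =>
      1640 * (2 * (((((F.P K).d + 2) * (F.P K).L : ℕ) : ℝ) * 0) + ((((F.P K).d + 2) * (F.P K).L : ℕ) : ℝ) ^ 2 / 4 * (2 * (2 * B₃ * (B₃ * t)) / ((F.P K).L : ℝ) ^ 2)) *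
        (((F.P K).L : ℝ) ^ ((F.P K).d - 1)) ^ 2) (by fun_prop) (by simp) one_pos).and <|
    eventually_nhdsGT_lt_of_continuous (f := fun t : ℝ =>
      13 * (2 * (((((F.P K).d + 2) * (F.P K).L : ℕ) : ℝ) * 0) + ((((F.P K).d + 2) * (F.P K).L : ℕ) : ℝ) ^ 2 / 4 * (2 * (2 * B₃ * (B₃ * t)) / ((F.P K).L : ℝ) ^ 2)) *
        ((F.P K).L : ℝ) ^ ((F.P K).d - 1)) (by fun_prop) (by simp) hδ
  obtain ⟨ε₀, hε₀, h24, h64, hL, hfed, hε₀a, hq3, hq2, hqa, hε3, hε2, hhi, hn1₀, hn2₀⟩ := Hε₀.exists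
  -- STEP 2: `εreg := 2B₃(B₃ε₀)`; the (hord) end at `ε₂₉ = 0` is the price
  have hord₀ : 2 * (2 * B₃ * (B₃ * ε₀)) / ((F.P K).L : ℝ) ^ 2 +
      4 * max 0 (10 * (((((F.P K).d + 2) * (F.P K).L : ℕ) : ℝ) * 0) * ((F.P K).L : ℝ) ^ ((F.P K).d - 1)) < ε₀ := by
    simp only [mul_zero, zero_mul, max_self, add_zero]
    rw [div_lt_iff₀ (pow_pos hL0 2)]
    nlinarith
  -- STEP 3: the threshold `ε₂₉ = s ↓ 0`
  have Hε := h0.and <|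
    (eventually_nhdsGT_lt_of_continuous_of_lt (f := fun s : ℝ =>
      1640 * (2 * (((((F.P K).d + 2) * (F.P K).L : ℕ) : ℝ) * s) + ((((F.P K).d + 2) * (F.P K).L : ℕ) : ℝ) ^ 2 / 4 * (2 * (2 * B₃ * (B₃ * ε₀)) / ((F.P K).L : ℝ) ^ 2)) *
        (((F.P K).L : ℝ) ^ ((F.P K).d - 1)) ^ 2) (by fun_prop) hn1₀).and <|
    (eventually_nhdsGT_lt_of_continuous_of_lt (f := fun s : ℝ =>
      13 * (2 * (((((F.P K).d + 2) * (F.P K).L : ℕ) : ℝ) * s) + ((((F.P K).d + 2) * (F.P K).L : ℕ) : ℝ) ^ 2 / 4 * (2 * (2 * B₃ * (B₃ * ε₀)) / ((F.P K).L : ℝ) ^ 2)) *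
        ((F.P K).L : ℝ) ^ ((F.P K).d - 1)) (by fun_prop) hn2₀).and <|
    eventually_nhdsGT_lt_of_continuous_of_lt (f := fun s : ℝ => 2 * (2 * B₃ * (B₃ * ε₀)) / ((F.P K).L : ℝ) ^ 2 +
        4 * max s (10 * (((((F.P K).d + 2) * (F.P K).L : ℕ) : ℝ) * s) * ((F.P K).L : ℝ) ^ ((F.P K).d - 1)))
      (((continuous_const).add (continuous_const.mul (continuous_id.max (by fun_prop))))) hord₀
  obtain ⟨ε₂₉, hε, hn1, hn2, hord'⟩ := Hε.exists
  exact ⟨2 * B₃ * (B₃ * ε₀), ε₂₉, ε₀, hε, by positivity, hε3, hε2, hn1.le, hn2, h24, h64, hL, hord', hfed, hε₀, hε₀a, hq3, hq2, hqa, le_rfl, hhi⟩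

end Summit.QuantumFields.YangMills.BalabanUVNodes.N09RecordDoorOfLocalRouteNumerics

end
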